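import Summits.ValiantsHypothesis.ValiantsHypothesis.Theorems.MonotoneRestorationOrbitRestorationQPTermCircuitWf
import HarnessLib

/-!
# The reduced term circuit: injectivity of the structure maps and decoding of the children

Route MonotoneRestoration, crux `OrbitRestorationQP` (stmt-ValiantsHypothesis-18293) — K3 machinery, namespace
`Summit.ValiantsHypothesis.ValiantsHypothesis.Theorems.TermCircuit`.  On the members of a closed universe the
gate maps are injective (`gateOf_injOn`, `rep_inj` — the latter uses the injectivity of `m ↦ (m : K)`,
i.e. characteristic `0`), the copies `Sc`/`Pl`/`Zr` are never confused with term gates, and the children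
SET of a node gate determines the MULTISET of its children and hence — children lists being sorted normal
forms — the node itself (`eq_of_children_sum_eq`, `eq_of_children_prod_eq`).  This is the decoding half of
"reduced" (Dawar–Wilsenach 2021, §3).  Everything is proved. [folklore]

## References
* A. Dawar, G. Wilsenach, *Symmetric arithmetic circuits*, ToC 21 (2025), Defs. 2.2, 3.6, 3.7, §3.3
  (`Orb`, `ORB`). [DawarWilsenach2025]
* A. Dawar, G. Wilsenach, *Symmetric circuits for rank logic*, ACM ToCL 23 (2021/22), §3 (syntactic
  equivalence, reduced circuits, unique extensions). [DawarWilsenach2021]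
* A. Dawar, B. Pago, T. Seppelt, *Symmetric algebraic circuits and homomorphism polynomials*,
  arXiv:2502.06740 (2025), §5. [DawarPagoSeppelt2025]
-/

noncomputable section

open scoped Classical

-- `Summit.ValiantsHypothesis.ValiantsHypothesis.…` is the tree's single-conjunct layout (Sub = Summit).
set_option linter.dupNamespace false

namespace Summit.ValiantsHypothesis.ValiantsHypothesis.Theorems

open Literature.Computability.AlgebraicComplexity

namespace TermCircuit

open HTerm

universe u v

variable {K : Type u} {X : Type v} [CommSemiring K] (𝒰 : Universe K X)

/-! ### Injectivity of the structure maps on the universe -/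

/-- `gateOf` is injective on members of the universe. [folklore] -/
theorem gateOf_injOn {u u' : HTerm K X} (hu : u ∈ 𝒰.T) (hu' : u' ∈ 𝒰.T)
    (h : gateOf 𝒰 u = gateOf 𝒰 u') : u = u' := by
  cases u with
  | var x =>
    cases u' with
    | var x' => simp only [gateOf, Gate.V.injEq] at h; rw [h]
    | const c' => rw [gateOf_const 𝒰 hu'] at h; simp [gateOf] at h
    | node b' l' => rw [gateOf_node 𝒰 hu'] at h; simp [gateOf] at h
  | const c =>
    rw [gateOf_const 𝒰 hu] at h
    cases u' with
    | var x' => simp [gateOf] at h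
    | const c' =>
      rw [gateOf_const 𝒰 hu'] at h
      simp only [Gate.C.injEq, Subtype.mk.injEq] at h
      rw [h]
    | node b' l' => rw [gateOf_node 𝒰 hu'] at h; simp at h
  | node b l =>
    rw [gateOf_node 𝒰 hu] at h
    cases u' with
    | var x' => simp [gateOf] at h
    | const c' => rw [gateOf_const 𝒰 hu'] at h; simp at h
    | node b' l' =>
      rw [gateOf_node 𝒰 hu'] at h
      simp only [Gate.T.injEq, Subtype.mk.injEq] at h
      exact h

/-- `gateOf` of a member is never a scaled copy. [folklore] -/
theorem gateOf_ne_Sc {u : HTerm K X} (hu : u ∈ 𝒰.T) (m : Fin (𝒰.M + 1)) (w : ↥𝒰.T) :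
    gateOf 𝒰 u ≠ Gate.Sc m w := by
  cases u with
  | var x => simp [gateOf]
  | const c => rw [gateOf_const 𝒰 hu]; simp
  | node b l => rw [gateOf_node 𝒰 hu]; simp

/-- `gateOf` of a member is never a plain copy. [folklore] -/
theorem gateOf_ne_Pl {u : HTerm K X} (hu : u ∈ 𝒰.T) (w : ↥𝒰.T) : gateOf 𝒰 u ≠ Gate.Pl w := by
  cases u with
  | var x => simp [gateOf]
  | const c => rw [gateOf_const 𝒰 hu]; simp
  | node b l => rw [gateOf_node 𝒰 hu]; simp

/-- `gateOf` of a member is never the zero gadget. [folklore] -/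
theorem gateOf_ne_Zr {u : HTerm K X} (hu : u ∈ 𝒰.T) : gateOf 𝒰 u ≠ Gate.Zr := by
  cases u with
  | var x => simp [gateOf]
  | const c => rw [gateOf_const 𝒰 hu]; simp
  | node b l => rw [gateOf_node 𝒰 hu]; simp

/-- `gateOf` of a member is never a constant gate unless the member is that constant. [folklore] -/
theorem gateOf_eq_C {u : HTerm K X} (hu : u ∈ 𝒰.T) {c : ↥(consts 𝒰)} (h : gateOf 𝒰 u = Gate.C c) :
    u = const c.1 := by
  cases u with
  | var x => simp [gateOf] at h
  | const c' =>
    rw [gateOf_const 𝒰 hu] at h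
    simp only [Gate.C.injEq] at h
    rw [← h]
  | node b l => rw [gateOf_node 𝒰 hu] at h; simp at h

/-- A representative of a member is never the zero gadget. [folklore] -/
theorem rep_ne_Zr {u : HTerm K X} (hu : u ∈ 𝒰.T) {m : ℕ} (hm : 1 ≤ m) (hmM : m ≤ 𝒰.M) :
    rep 𝒰 u m ≠ Gate.Zr := by
  by_cases h1 : m = 1
  · subst h1; rw [rep_one]; exact gateOf_ne_Zr 𝒰 hu
  · rw [rep_of_ne_one 𝒰 hu h1 hmM]; simp

/-- A representative of a member is never a plain copy. [folklore] -/
theorem rep_ne_Pl {u : HTerm K X} (hu : u ∈ 𝒰.T) {m : ℕ} (hm : 1 ≤ m) (hmM : m ≤ 𝒰.M)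
    (w : ↥𝒰.T) : rep 𝒰 u m ≠ Gate.Pl w := by
  by_cases h1 : m = 1
  · subst h1; rw [rep_one]; exact gateOf_ne_Pl 𝒰 hu w
  · rw [rep_of_ne_one 𝒰 hu h1 hmM]; simp

/-- **Representatives are injective** in (member, multiplicity) — here the injectivity of
`m ↦ (m : K)` (characteristic zero) enters. [folklore] -/
theorem rep_inj [CharZero K] {u u' : HTerm K X} (hu : u ∈ 𝒰.T) (hu' : u' ∈ 𝒰.T) {m m' : ℕ}
    (hm : 1 ≤ m) (hmM : m ≤ 𝒰.M) (hm' : 1 ≤ m') (hmM' : m' ≤ 𝒰.M)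
    (h : rep 𝒰 u m = rep 𝒰 u' m') : u = u' ∧ m = m' := by
  by_cases h1 : m = 1
  · subst h1
    by_cases h1' : m' = 1
    · subst h1'
      rw [rep_one, rep_one] at h
      exact ⟨gateOf_injOn 𝒰 hu hu' h, rfl⟩
    · rw [rep_one, rep_of_ne_one 𝒰 hu' h1' hmM'] at h
      exact absurd h (gateOf_ne_Sc 𝒰 hu _ _)
  · by_cases h1' : m' = 1
    · subst h1'
      rw [rep_one, rep_of_ne_one 𝒰 hu h1 hmM] at h
      exact absurd h.symm (gateOf_ne_Sc 𝒰 hu' _ _)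
    · rw [rep_of_ne_one 𝒰 hu h1 hmM, rep_of_ne_one 𝒰 hu' h1' hmM'] at h
      simp only [Gate.Sc.injEq, Fin.mk.injEq, Subtype.mk.injEq] at h
      exact ⟨h.2, h.1⟩

omit [CommSemiring K] in
/-- The children list of a node of the universe is sorted: `tsort l = l`. [folklore] -/
theorem tsort_eq_self_of_mem {b : Bool} {l : List (HTerm K X)} (h : node b l ∈ 𝒰.T) : tsort l = l := by
  have hn := 𝒰.normal _ h
  rw [normalize_node] at hn
  simp only [node.injEq, true_and] at hn
  have hl : l.map normalize = l := by
    conv_rhs => rw [← List.map_id l]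
    exact List.map_congr_left fun u hu => 𝒰.normal u (𝒰.closed b l h u hu)
  rwa [hl] at hn

/-- **Decoding the children of a sum node**: the children set determines the multiset of summands.
[folklore] -/
theorem eq_of_children_sum_eq [CharZero K] {l l' : List (HTerm K X)} (hl : node false l ∈ 𝒰.T)
    (hl' : node false l' ∈ 𝒰.T)
    (h : (l.map fun u => rep 𝒰 u (l.count u)).toFinset = (l'.map fun u => rep 𝒰 u (l'.count u)).toFinset) :
    l = l' := by
  have key : ∀ (l l' : List (HTerm K X)), node false l ∈ 𝒰.T → node false l' ∈ 𝒰.T →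
      (l.map fun u => rep 𝒰 u (l.count u)).toFinset = (l'.map fun u => rep 𝒰 u (l'.count u)).toFinset →
      ∀ w ∈ l, l.count w = l'.count w := by
    intro l l' hl hl' h w hw
    have hmem : rep 𝒰 w (l.count w) ∈ (l'.map fun u => rep 𝒰 u (l'.count u)).toFinset := by
      rw [← h, List.mem_toFinset, List.mem_map]
      exact ⟨w, hw, rfl⟩
    rw [List.mem_toFinset, List.mem_map] at hmem
    obtain ⟨w', hw', hww'⟩ := hmem
    have := rep_inj 𝒰 (𝒰.closed _ _ hl' w' hw') (𝒰.closed _ _ hl w hw)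
      (List.count_pos_iff.2 hw') (𝒰.count_le l' hl' w') (List.count_pos_iff.2 hw) (𝒰.count_le l hl w)
      hww'
    obtain ⟨rfl, h2⟩ := this
    exact h2.symm
  have hperm : l.Perm l' := by
    rw [List.perm_iff_count]
    intro w
    by_cases hw : w ∈ l
    · exact key l l' hl hl' h w hw
    · by_cases hw' : w ∈ l'
      · exact (key l' l hl' hl h.symm w hw').symm
      · rw [List.count_eq_zero_of_not_mem hw, List.count_eq_zero_of_not_mem hw']
  rw [← tsort_eq_self_of_mem 𝒰 hl, ← tsort_eq_self_of_mem 𝒰 hl', tsort_eq_of_perm hperm]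

/-- **Decoding the children of a product node** (binary). [folklore] -/
theorem eq_of_children_prod_eq {l l' : List (HTerm K X)} (hl : node true l ∈ 𝒰.T)
    (hl' : node true l' ∈ 𝒰.T)
    (h : children 𝒰 (Gate.T ⟨node true l, node_mem_nodes 𝒰 hl⟩) =
      children 𝒰 (Gate.T ⟨node true l', node_mem_nodes 𝒰 hl'⟩)) : l = l' := by
  obtain ⟨a, c, rfl⟩ := List.length_eq_two.1 (𝒰.binary l hl)
  obtain ⟨a', c', rfl⟩ := List.length_eq_two.1 (𝒰.binary l' hl')
  have ha : a ∈ 𝒰.T := 𝒰.closed _ _ hl a (by simp)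
  have hc : c ∈ 𝒰.T := 𝒰.closed _ _ hl c (by simp)
  have ha' : a' ∈ 𝒰.T := 𝒰.closed _ _ hl' a' (by simp)
  have hc' : c' ∈ 𝒰.T := 𝒰.closed _ _ hl' c' (by simp)
  by_cases hac : a = c
  · subst hac
    rw [children_T_sq 𝒰 _ a rfl ha] at h
    by_cases hac' : a' = c'
    · subst hac'
      rw [children_T_sq 𝒰 _ a' rfl ha'] at h
      have : gateOf 𝒰 a ∈ ({gateOf 𝒰 a', Gate.Sc ⟨1, _⟩ ⟨a', ha'⟩} : Finset (Gate 𝒰)) :=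
        h ▸ Finset.mem_insert_self _ _
      simp only [Finset.mem_insert, Finset.mem_singleton] at this
      rcases this with h1 | h1
      · rw [gateOf_injOn 𝒰 ha ha' h1]
      · exact absurd h1 (gateOf_ne_Sc 𝒰 ha _ _)
    · rw [children_T_pair 𝒰 _ a' c' rfl hac'] at h
      have : Gate.Sc ⟨1, by have := 𝒰.one_le; omega⟩ ⟨a, ha⟩ ∈
          ({gateOf 𝒰 a', gateOf 𝒰 c'} : Finset (Gate 𝒰)) := by rw [← h]; simp
      simp only [Finset.mem_insert, Finset.mem_singleton] at this
      rcases this with h1 | h1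
      · exact absurd h1.symm (gateOf_ne_Sc 𝒰 ha' _ _)
      · exact absurd h1.symm (gateOf_ne_Sc 𝒰 hc' _ _)
  · rw [children_T_pair 𝒰 _ a c rfl hac] at h
    by_cases hac' : a' = c'
    · subst hac'
      rw [children_T_sq 𝒰 _ a' rfl ha'] at h
      have : Gate.Sc ⟨1, by have := 𝒰.one_le; omega⟩ ⟨a', ha'⟩ ∈
          ({gateOf 𝒰 a, gateOf 𝒰 c} : Finset (Gate 𝒰)) := by rw [h]; simp
      simp only [Finset.mem_insert, Finset.mem_singleton] at this
      rcases this with h1 | h1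
      · exact absurd h1.symm (gateOf_ne_Sc 𝒰 ha _ _)
      · exact absurd h1.symm (gateOf_ne_Sc 𝒰 hc _ _)
    · rw [children_T_pair 𝒰 _ a' c' rfl hac'] at h
      -- two distinct factors on both sides: the underlying sets agree
      have hmem : ∀ {p : HTerm K X}, p ∈ 𝒰.T →
          gateOf 𝒰 p ∈ ({gateOf 𝒰 a', gateOf 𝒰 c'} : Finset (Gate 𝒰)) → p = a' ∨ p = c' := by
        intro p hp hh
        simp only [Finset.mem_insert, Finset.mem_singleton] at hh
        rcases hh with h1 | h1
        · exact Or.inl (gateOf_injOn 𝒰 hp ha' h1)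
        · exact Or.inr (gateOf_injOn 𝒰 hp hc' h1)
      have hA := hmem ha (h ▸ (by simp))
      have hC := hmem hc (h ▸ (by simp))
      have hperm : [a, c].Perm [a', c'] := by
        rcases hA with rfl | rfl
        · rcases hC with rfl | rfl
          · exact absurd rfl hac
          · exact List.Perm.refl _
        · rcases hC with rfl | rfl
          · exact List.Perm.swap _ _ []
          · exact absurd rfl hac
      rw [← tsort_eq_self_of_mem 𝒰 hl, ← tsort_eq_self_of_mem 𝒰 hl', tsort_eq_of_perm hperm]

end TermCircuit

end Summit.ValiantsHypothesis.ValiantsHypothesis.Theorems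

end
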